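import Summits.BirchSwinnertonDyer.BirchSwinnertonDyer.Theses.EisensteinPrimes
import Summits.BirchSwinnertonDyer.BirchSwinnertonDyer.Theorems.EisensteinPrimesGoodLatticeBDPValueOfFacts
import Summits.BirchSwinnertonDyer.BirchSwinnertonDyer.Theorems.EisensteinPrimesGoodLatticeBDPValueOfOneInequality
import Summits.BirchSwinnertonDyer.BirchSwinnertonDyer.Theorems.EisensteinPrimesGoodLatticeBDPValueOfLambdaIdentity
import Summits.BirchSwinnertonDyer.BirchSwinnertonDyer.Theorems.EisensteinPrimesGoodLatticeBDPValueOfLambdaIdentityAnQ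
import Summits.BirchSwinnertonDyer.BirchSwinnertonDyer.Theorems.EisensteinPrimesGoodLatticeBDPValueOfLambdaInequalityAnQ
import Summits.BirchSwinnertonDyer.BirchSwinnertonDyer.Theorems.EisensteinPrimesResidualIndexAssembly
import Summits.BirchSwinnertonDyer.Rank1Residual.X2.ResidualDevissageModules
import Literature.NumberTheory.GaloisCohomology.PoitouTateRestrictedRamification
import Literature.NumberTheory.EllipticCurves.PAdicHeights
import Summits.BirchSwinnertonDyer.BirchSwinnertonDyer.Theorems.EisensteinPrimesGoodLatticeBDPValueIndexInputsStub
import Summits.BirchSwinnertonDyer.BirchSwinnertonDyer.Theorems.EisensteinPrimesIndexPlumbingLambdaLE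
import Summits.BirchSwinnertonDyer.BirchSwinnertonDyer.Theorems.EisensteinPrimesAnticyclotomicLocalCdOne
import Summits.BirchSwinnertonDyer.BirchSwinnertonDyer.Theorems.EisensteinPrimesAnomalousTowerTorsionFinite
import Summits.BirchSwinnertonDyer.BirchSwinnertonDyer.Theorems.EisensteinPrimesFSideCorankLe
import Literature.NumberTheory.EllipticCurves.CastellaGrossiLeeSkinner2022.KatzPAdicLFunctionExistence
import Summits.BirchSwinnertonDyer.BirchSwinnertonDyer.Theorems.EisensteinPrimesGoodLatticeBDPValueStubKatzLineIntFrameQ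
import Summits.BirchSwinnertonDyer.BirchSwinnertonDyer.Theorems.EisensteinPrimesKatzLineDescentOfThm212
import Summits.BirchSwinnertonDyer.BirchSwinnertonDyer.Theorems.EisensteinPrimesGoodLatticeImprimitiveOfQuotient
import Summits.BirchSwinnertonDyer.BirchSwinnertonDyer.Theorems.EisensteinPrimesGoodLatticeQuotientOfCorank
import Summits.BirchSwinnertonDyer.BirchSwinnertonDyer.Theorems.EisensteinPrimesGoodLatticeCorankOfGe
import Summits.BirchSwinnertonDyer.BirchSwinnertonDyer.Theorems.EisensteinPrimesAcTwistDeformationImprimCorank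
import Summits.BirchSwinnertonDyer.BirchSwinnertonDyer.Theorems.EisensteinPrimesGoodLatticeBDPValueFullDescentStub
import Summits.BirchSwinnertonDyer.BirchSwinnertonDyer.Theorems.EisensteinPrimesGoodLatticeBDPValuePublishedFactsOfTextbook
import Summits.BirchSwinnertonDyer.BirchSwinnertonDyer.Theorems.EisensteinPrimesGoodLatticeBDPValueSec33OfThm331
import Summits.BirchSwinnertonDyer.BirchSwinnertonDyer.Theorems.EisensteinPrimesGoodLatticeBDPValueStubOneOfPrint
import Summits.BirchSwinnertonDyer.BirchSwinnertonDyer.Theorems.EisensteinPrimesGoodLatticeBDPValueStubIndexPlumbing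
import Summits.BirchSwinnertonDyer.BirchSwinnertonDyer.Theorems.EisensteinPrimesGoodLatticeBDPValueOfNamedFactsSix
import Summits.BirchSwinnertonDyer.BirchSwinnertonDyer.Theorems.EisensteinPrimesGoodLatticeBDPValueAnThreeBookkeeping
import HarnessLib
/-!
# Crux `GoodLatticeBDPValue` (stmt-BirchSwinnertonDyer-19032), line `halves` v23: THE CRUX BY NAME AS A CONDITIONAL KERNEL
# THEOREM ON EXACTLY THE FOUR v23 STUB STATEMENTS (twelve published named facts ∧ 3a-A)

Cell `bsd-eis` (run/shared/lean/pub/bsd-eis/), LEAD seat `bsd-line-x1-p1` gen 6, RESHAPE #26 (halves v22 → v23, skeleton sha256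
9d825c144e719dbd…, host RECORD #95). `--supports stmt-BirchSwinnertonDyer-19032`. v23's composition `GoodLatticeBDPValue_of` with
its four `sorry` stubs turned into HYPOTHESES BY VALUE (section `variable`s), as `GoodLatticeBDPValueOfNamedFacts{ALG,}` (LEAD g5,
p660207 / p660812) were for v22's five. The four statements: `stub_publishedFacts` (FIVE published facts on the BDP / CM side: CGLS
2022 proof of Thm. 4.2.2, CGLS Thm. 5.1.3 (disc), Bleher et al. 2020 Thm. 3.3.1, de Shalit 1987 II.6.4, Hida 2010 Thm. I),
`stub_anacongOfFullDescentDatum` (3a-A: [AN] given a full-descent datum — PUB-composed candidate, referee C3's question; Literature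
candidate `Cruxes/GoodLatticeBDPValue/Lines/halves_3aA_literature_candidate.lean`), `stub_publishedFactsGreenberg` (Greenberg 2016
Prop. 4.1.1, weak Leopoldt T4, and the two TEXTBOOK facts Milne ADT I Thm. 5.1 / Harari Thm. 17.13 (a) at every number field),
`stub_publishedFactsMore` (Greenberg 2016 Prop. 2.6.3, `thm222_anacong_goodLattice_of_five_le`, CGLS Thm. 2.1.2).

Results (sorry-free, CONDITIONAL on the hypotheses they name):
* `publishedFactsGreenberg_v22` — v10–v22's eight-conjunct stub 4, token for token, from v23's stub 4 and stub 1's Thm. 3.3.1 (w2 gen 6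
  `GoodLatticeBDPValuePublishedFactsOfTextbook.publishedFactsGreenberg_of_textbook`, p660402: Greenberg 2016 Prop. 4.2.2, Greenberg
  2006 §5 A / Prop. 4.2 are TREE THEOREMS, Props. 3.2 / 4.1 follow from the two textbook facts; w6 gen 2
  `GoodLatticeBDPValueSec33OfThm331.sec33_of_thm331`, p661944);
* `imprimLambdaLE_of_index` — [ALG-imp-λ] in cotorsion `≤` form (the v20–v23 skeleton glue: `indexInputs` fed by
  `….indexInputs_of_textbook`, which needs `cd_p(G_{K,Σ}) ≤ 2` at the imaginary quadratic `K` only — from Poitou–Tate, so v22's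
  stub 4c is gone —, and w8's `IndexPlumbingNrVsStrict.stub_indexPlumbing`);
* `goodLatticeBDPValue_of_namedFacts₂₃ : ⟨stub 1⟩ → ⟨3a-A⟩ → ⟨stub 4⟩ → ⟨stub 4b⟩ → Theses.EisensteinPrimes.GoodLatticeBDPValue` — via
  the terminal consumer `GoodLatticeBDPValueStubOneOfPrint.goodLatticeBDPValue_of_print_of_leTD_of_le_of_anQ` (LEAD g6 p662689, on
  w4 gen 10 p662161 / w3 gen 7 p661564: no Castella–Hsieh, no Carayol, CGLS 5.1.3 (disc)) and the ℚ-currency [AN] glue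
  `GoodLatticeBDPValueOfNamedFactsSix.anQ_of_thm222_OPEN` (w5 gen 2 p662183) fed with
  `GoodLatticeBDPValueAnThreeBookkeeping.thm222_OPEN_of_fullDescentDatum_of_five_le` (LEAD g5 p660970: [AN] at every odd `p` ⇐ 3a-A
  at the full-descent datum of the CLOSED stub 3a-B, p658450, and the `5 ≤ p` slice — so `thm222_anacong_goodLattice_of_ne_one` is
  NOT an input).

So after v23 the crux BY NAME is conditional on TWELVE published named facts (research: CGLS 2022 proof of Thm. 4.2.2, Thm. 5.1.3
(disc), Thm. 2.1.2; Bleher et al. 2020 Thm. 3.3.1; de Shalit 1987 II.6.4; Hida 2010 Thm. I; Greenberg 2016 Props. 4.1.1, 2.6.3;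
Greenberg 2006 / NQD 1984 T4; the PUB-composed `thm222_anacong_goodLattice_of_five_le`; textbook: Milne ADT I Thm. 5.1, Harari
Thm. 17.13 (a)) and the one PUB-composed residue 3a-A. HONEST FRAMING: CONDITIONAL theorems (audit `proof.conditional`); they close
nothing; no summit statement / BSD / KY Thm. 1.4.1 / 2.2.2 / the crux is proved here; 0 cells / labels move.
References: those of the v23 skeleton `Cruxes/GoodLatticeBDPValue/Lines/halves.lean`, of p660207 / p660812 and of the files named.
-/

-- `Summit.BirchSwinnertonDyer.BirchSwinnertonDyer.…`: the summit and its single sub-problem share a name (D-0017 layout).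
set_option linter.dupNamespace false
set_option autoImplicit false

namespace Summit.BirchSwinnertonDyer.BirchSwinnertonDyer.Theorems.GoodLatticeBDPValueOfNamedFactsV23

open scoped Classical

open PowerSeries WeierstrassCurve NumberField IsDedekindDomain Field
  Literature.NumberTheory.GaloisRepresentations Literature.NumberTheory.EllipticCurves.GreenbergVatsal2000
  Summit.BirchSwinnertonDyer.BirchSwinnertonDyer.Theorems.EisensteinPrimesMuLambda
  Literature.NumberTheory.EllipticCurves Literature.NumberTheory.EllipticCurves.ModularForms
  Literature.NumberTheory.EllipticCurves.Rank1Residual Literature.NumberTheory.EllipticCurves.Castella2018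
  Literature.NumberTheory.EllipticCurves.GreenbergSelmer Literature.NumberTheory.QuadraticFields
  Literature.NumberTheory.EllipticCurves.CastellaGrossiLeeSkinner2022
  Literature.NumberTheory.EllipticCurves.KellerYin2024 Literature.NumberTheory.EllipticCurves.IwasawaAlgebra
  Literature.NumberTheory.EllipticCurves.Rubin1991 Literature.NumberTheory.EllipticCurves.DeShalit1987
  Literature.NumberTheory.EllipticCurves.Hida2010MuInvariant Literature.NumberTheory.EllipticCurves.BCGKPST2020
open Literature.NumberTheory.IwasawaTheory Literature.NumberTheory.IwasawaTheory.Greenberg2016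
  Literature.NumberTheory.IwasawaTheory.Greenberg2006
open Summit.BirchSwinnertonDyer.Rank1Residual.X1.KellerYinHalves
  Summit.BirchSwinnertonDyer.Rank1Residual.X2.ResidualDevissageModules
  Summit.BirchSwinnertonDyer.Rank1Residual.X1.KellerYinMuLambdaSplitDSFree
  Summit.BirchSwinnertonDyer.BirchSwinnertonDyer.Theorems
  Summit.BirchSwinnertonDyer.BirchSwinnertonDyer.Theorems.GoodLatticeBDPValueHalves
  Summit.BirchSwinnertonDyer.BirchSwinnertonDyer.Theorems.GoodLatticeBDPValueOfImprimitive
  Summit.BirchSwinnertonDyer.BirchSwinnertonDyer.Theorems.GoodLatticeBDPValueOfOneInequality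
  Summit.BirchSwinnertonDyer.BirchSwinnertonDyer.Theorems.GoodLatticeImprimitiveOfQuotient
  Summit.BirchSwinnertonDyer.BirchSwinnertonDyer.Theorems.GoodLatticeQuotientOfCorank
  Summit.BirchSwinnertonDyer.BirchSwinnertonDyer.Theorems.GoodLatticeCorankOfGe


/-! ### The four v23 stub statements enter each theorem below as EXPLICIT hypotheses named like the stubs
(`stub_publishedFacts`, `stub_anacongOfFullDescentDatum`, `stub_publishedFactsGreenberg`, `stub_publishedFactsMore`);
their texts are the registered ones, token for token (ledger `payload.skeleton.sha` 9d825c14…). -/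

/-- **Stub 4's v10–v22 statement (eight conjuncts, token for token), DERIVED (v23)** from the five conjuncts of the new stub 4 by
`GoodLatticeBDPValuePublishedFactsOfTextbook.publishedFactsGreenberg_of_textbook` (p660402); feeds every consumer typed against
the old text. [cite: Greenberg2016Selmer, Prop. 4.1.1, Prop. 4.2.2] [cite: Greenberg2006, §5 A, Prop. 4.1, Prop. 4.2, Prop. 3.2] -/
theorem publishedFactsGreenberg_v22
    (stub_publishedFacts :
      proofThm422_exists_isBDPLFunction_isTorsion_charIdeal_dvd ∧
        thm513_exists_isBDPLFunction_valueAtOne_disc ∧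
        thm331_rubin_exists_katzMeasure₂_pseudoIso_span_eq ∧
        thmII64_katzMeasure₂_functionalEquation ∧
        thmI_mu_katzBranch_reflect_eq_zero)
    (stub_publishedFactsGreenberg :
      prop411_selmer_isAlmostDivisible ∧ weakLeopoldt_H2_subsingleton_above_cyclotomic_of_isOpen ∧
        (∀ (L : Type) [Field L] [NumberField L], Literature.NumberTheory.GaloisCohomology.tateGlobalEulerPoincareCharacteristic L) ∧
        (∀ (L : Type) [Field L] [NumberField L], Literature.NumberTheory.GaloisCohomology.poitouTate_restricted_three_le L)) :
    prop411_selmer_isAlmostDivisible ∧ prop422_localCohomology_isAlmostDivisible ∧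
      sec5A_localH2_subsingleton_of_LOC1 ∧ prop41_globalEulerPoincareCorank ∧
      prop42_localEulerPoincareCorank ∧ prop32_cohomology_isCofinitelyGenerated ∧
      BCGKPST2020.sec33_rubin_unrSelmer₂_finite_torsion ∧
      weakLeopoldt_H2_subsingleton_above_cyclotomic_of_isOpen :=
  GoodLatticeBDPValuePublishedFactsOfTextbook.publishedFactsGreenberg_of_textbook stub_publishedFactsGreenberg.1
    stub_publishedFactsGreenberg.2.2.1 stub_publishedFactsGreenberg.2.2.2
    (GoodLatticeBDPValueSec33OfThm331.sec33_of_thm331 stub_publishedFacts.2.2.1) stub_publishedFactsGreenberg.2.1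

/-! ### Kernel glue for [ALG-imp-λ] (sorry-free): the `λ`-identity of KY Thm. 1.4.1 (iii), cotorsion form, DERIVED -/
/-- **[ALG-imp-λ] in cotorsion `≤` form, derived**: the `≤` half of v19.1's PRE stub `stub_imprimLambda` with the cotorsion /
`μ = 0` antecedents (= the hypothesis `h141leTD` of `GoodLatticeBDPValueOfLambdaInequalityAnQ`), from stub 2a-I (inputs,
fed the PUB facts of stubs 4/4b), the LANDED mid-level composition `ResidualIndexAssembly.zpCorank_datumStrictSelmer_add_eq`
(p645893) and stub 2a-II (plumbing). [cite: KellerYin2024, Thm. 1.4.1 (iii)] -/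
theorem imprimLambdaLE_of_index
    (stub_publishedFacts :
      proofThm422_exists_isBDPLFunction_isTorsion_charIdeal_dvd ∧
        thm513_exists_isBDPLFunction_valueAtOne_disc ∧
        thm331_rubin_exists_katzMeasure₂_pseudoIso_span_eq ∧
        thmII64_katzMeasure₂_functionalEquation ∧
        thmI_mu_katzBranch_reflect_eq_zero)
    (stub_publishedFactsGreenberg :
      prop411_selmer_isAlmostDivisible ∧ weakLeopoldt_H2_subsingleton_above_cyclotomic_of_isOpen ∧
        (∀ (L : Type) [Field L] [NumberField L], Literature.NumberTheory.GaloisCohomology.tateGlobalEulerPoincareCharacteristic L) ∧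
        (∀ (L : Type) [Field L] [NumberField L], Literature.NumberTheory.GaloisCohomology.poitouTate_restricted_three_le L))
    (stub_publishedFactsMore :
      prop263_sur_of_crk ∧ thm222_anacong_goodLattice_of_five_le ∧ thm212_exists_isKatzLFunction) :
    ∀ (W : WeierstrassCurve ℚ) [W.IsElliptic] [W.IsGloballyMinimal] (p : ℕ) [Fact p.Prime],
      2 < p → Good W p → Red W p → Anom W p →
      (∀ Φ : AddSubgroup (geomTorsion W (p : ℤ)), IsRationalLine W p Φ → ¬ LineUnramifiedAt W p Φ) →
      ∀ (K : Type) [Field K] [NumberField K], IsImaginaryQuadratic K →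
        SatisfiesHeegnerHypothesis (W.conductorNorm ℤ) K → SatisfiesHeegnerHypothesis p K →
        (∀ Q : (W.baseChange K).toAffine.Point, p • Q = 0 → Q = 0) →
      ∀ (ι : K →+* ℚ_[p]) (v vbar : HeightOneSpectrum (𝓞 K)),
        (∀ x : 𝓞 K, x ∈ v.asIdeal ↔ ‖ι (x : K)‖ < 1) →
        ((p : ℕ) : 𝓞 K) ∈ vbar.asIdeal → vbar ≠ v →
      ∀ (κ : ZpExtension K p), κ.IsAnticyclotomic →
      ∀ (γ : absoluteGaloisGroup K) [Fact (κ.IsTopGenerator γ)],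
      ∀ (θsub θquot : FramedGaloisRep K (padicCoeffIntegers (∅ : Set (PadicAlgCl p))) 1),
        IsResidualPairOver (W.baseChange K) p θsub θquot →
      ∀ (Sf : Finset (HeightOneSpectrum (𝓞 K))),
        (∀ w : HeightOneSpectrum (𝓞 K), w ∈ Sf ↔ ((W.conductorNorm ℤ : ℤ) : 𝓞 K) ∈ w.asIdeal) →
      ∀ (DSsub : DatumDualData κ γ (charModule ∅ θsub)
          (AcSelmer.bdpData (charModule ∅ θsub) p vbar) (↑Sf : Set (HeightOneSpectrum (𝓞 K))))
        (DSquot : DatumDualData κ γ (charModule ∅ θquot)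
          (AcSelmer.bdpData (charModule ∅ θquot) p vbar) (↑Sf : Set (HeightOneSpectrum (𝓞 K)))),
      Module.Finite (IwasawaAlgebra p) (AcSelmer.XAc (W.baseChange K) p κ vbar (↑Sf : Set (HeightOneSpectrum (𝓞 K))) γ) →
      Module.IsTorsion (IwasawaAlgebra p) (AcSelmer.XAc (W.baseChange K) p κ vbar (↑Sf : Set (HeightOneSpectrum (𝓞 K))) γ) →
      muInvariant p (AcSelmer.XAc (W.baseChange K) p κ vbar (↑Sf : Set (HeightOneSpectrum (𝓞 K))) γ) = 0 →
      (∀ D : DatumDualData κ γ (charModule ∅ θsub)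
          (AcSelmer.bdpData (charModule ∅ θsub) p vbar) (↑Sf : Set (HeightOneSpectrum (𝓞 K))),
        Module.Finite (IwasawaAlgebra p) D.X ∧ Module.IsTorsion (IwasawaAlgebra p) D.X ∧ muInvariant p D.X = 0) →
      (∀ D : DatumDualData κ γ (charModule ∅ θquot)
          (AcSelmer.bdpData (charModule ∅ θquot) p vbar) (↑Sf : Set (HeightOneSpectrum (𝓞 K))),
        Module.Finite (IwasawaAlgebra p) D.X ∧ Module.IsTorsion (IwasawaAlgebra p) D.X ∧ muInvariant p D.X = 0) →
      lambdaInvariant p DSsub.X + lambdaInvariant p DSquot.X ≤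
        lambdaInvariant p (AcSelmer.XAc (W.baseChange K) p κ vbar (↑Sf : Set (HeightOneSpectrum (𝓞 K))) γ) +
          (if ∀ σ : absoluteGaloisGroup K, θquot σ = 1 then 1 else 0) := by
  intro W _ _ p _ hp hgood hred hanom hlat K _ _ hK hH hHp htor ι v vbar hv hvbar hne κ hκ γ _ θsub θquot hpair Sf hSf
    DSsub DSquot hfgS htorS hμS hSsub hSquot
  obtain ⟨h411, h422, h5A, h41, h42, h32, h33, hT4⟩ :=
    publishedFactsGreenberg_v22 stub_publishedFacts stub_publishedFactsGreenberg
  obtain ⟨c, τ, Φ, j₁, j₃, hj₁, hj₃, hτ, hdist, hreps₁, hreps₂, hreps₃, hj₁inj, hj₃inj, hr₁, hr₃, hr₂, hd₂, hUi, hU₁, hU₂,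
    hU₃, hsur₁, hsur₂, hsur₃, hprim₁, hprim₂, hprim₃, hfin₁, hfin₂, hfin₃, hinv₁, hinv₂, hinv₃, hN₂, hfinq, hε, hN₁D,
    htrivD, hfinQ, hN₃, hinvD₁, hinvD₃, hH2⟩ :=
    GoodLatticeBDPValuePublishedFactsOfTextbook.indexInputs_of_textbook stub_publishedFactsMore.1 stub_publishedFactsGreenberg.2.2.1
      stub_publishedFactsGreenberg.2.2.2
      W p hp hgood hred hanom hlat K hK hH hHp htor ι v vbar hv hvbar hne κ hκ γ θsub θquot hpair Sf hSf hfgS htorS hμS hSsub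
      hSquot
  haveI := hfin₁; haveI := hfin₂; haveI := hfin₃; haveI := hfinq; haveI := hfinQ
  haveI hEK : (W.baseChange K).IsElliptic := inferInstanceAs (W.map (algebraMap ℚ K)).IsElliptic
  have hcN₂ : ∀ b : ↥((W.baseChange K).geomTorsion (p : ℤ)), Continuous fun σ : absoluteGaloisGroup K ↦ σ • b :=
    fun b ↦ continuous_of_injective_comp (G := absoluteGaloisGroup K) Subtype.val_injective
      ((W.baseChange K).continuous_smul_geomPoints (b : geomPoints (W.baseChange K)))
  -- DIV ×3 and LRS: `cd_p(ker κ ⊓ D_v̄) ≤ 1` (w4 gen 3, `AnticyclotomicLocalCdOne`)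
  have hneD : ∃ τ ∈ decomp (K := K) vbar, κ τ ≠ 1 :=
    AnticyclotomicLocalCdOne.exists_mem_decomp_apply_ne_one_of_isAnticyclotomic κ vbar hK hp.ne' hκ hvbar
  have hdiv₁ : ∀ y : subgroupH1 (κ.kerSubgroup ⊓ decomp vbar) (charModule ∅ θsub), ∃ y', p • y' = y := fun y ↦ by
    obtain ⟨y', hy'⟩ := AnticyclotomicLocalCdOne.exists_eq_nsmul_subgroupH1_inf_decomp κ vbar hneD
      (CharResidualSelmerCount.continuous_smul_charModule θsub) (CharResidualSelmerCount.charModule_divisible θsub) y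
    exact ⟨y', hy'.symm⟩
  have hdiv₂ : ∀ y : subgroupH1 (κ.kerSubgroup ⊓ decomp vbar) ↥((W.baseChange K).geomPrimaryTorsion p),
      ∃ y', p • y' = y := fun y ↦ by
    obtain ⟨y', hy'⟩ := AnticyclotomicLocalCdOne.exists_eq_nsmul_subgroupH1_inf_decomp κ vbar hneD
      ((W.baseChange K).continuous_smul_geomPrimaryTorsion p) hd₂ y
    exact ⟨y', hy'.symm⟩
  have hdiv₃ : ∀ y : subgroupH1 (κ.kerSubgroup ⊓ decomp vbar) (charModule ∅ θquot), ∃ y', p • y' = y := fun y ↦ by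
    obtain ⟨y', hy'⟩ := AnticyclotomicLocalCdOne.exists_eq_nsmul_subgroupH1_inf_decomp κ vbar hneD
      (CharResidualSelmerCount.continuous_smul_charModule θquot) (CharResidualSelmerCount.charModule_divisible θquot) y
    exact ⟨y', hy'.symm⟩
  have hpQ : ∀ Q : ↥((W.baseChange K).geomTorsion (p : ℤ)), p • Q = 0 := fun Q ↦ by
    apply Subtype.ext
    have h := (mem_geomTorsion_iff (W.baseChange K) (p : ℤ) (Q : geomPoints (W.baseChange K))).mp Q.2
    rw [AddSubmonoidClass.coe_nsmul, ← natCast_zsmul, h]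
    rfl
  have hlrs := AnticyclotomicLocalCdOne.resH1Hom_id_surjective_inf_decomp κ vbar hneD
    (fun a ↦ Φ.continuous_smul_sub hcN₂ a) hcN₂ (fun a ↦ Φ.continuous_smul_quot hcN₂ a)
    (fun n ↦ ⟨1, Φ.incl_injective (by rw [map_nsmul, map_zero, pow_one]; exact hpQ _)⟩)
    Φ.incl Φ.incl_smul Φ.incl_injective Φ.proj Φ.proj_smul Φ.proj_incl
    (fun b hb ↦ Φ.mem_range_incl_of_proj_eq_zero b hb) Φ.proj_surjective
  -- FIN: `E(K_{∞,w̄})[p^∞]` is finite (w2 gen 3, `AnomalousLocalTorsion`)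
  haveI hfinED : Finite {x : ↥((W.baseChange K).geomPrimaryTorsion p) // ∀ g : ↥(κ.kerSubgroup ⊓ decomp vbar), g • x = x} := by
    have hF := AnomalousLocalTorsion.localTowerTorsionFiniteAt_of_isAnticyclotomic W hp.ne' hanom hlat hK
      (IwasawaTwoVariable.natCast_mem_asIdeal_of_norm_iff hv) hvbar hne κ hκ
    haveI := hF.to_subtype
    refine Finite.of_injective (fun x ↦ (⟨x.1, (FixedPoints.mem_addSubgroup _ _ _).mpr fun g ↦
      x.2 ⟨g.1, by rw [inf_comm]; exact g.2⟩⟩ :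
        (FixedPoints.addSubgroup ↥(decomp (K := K) vbar ⊓ κ.kerSubgroup) ↥((W.baseChange K).geomPrimaryTorsion p) :
          Set ↥((W.baseChange K).geomPrimaryTorsion p)))) fun a b h ↦ Subtype.ext ?_
    simpa using congrArg Subtype.val h
  have hmid := ResidualIndexAssembly.zpCorank_datumStrictSelmer_add_eq κ.kerSubgroup p
    (↑Sf : Set (HeightOneSpectrum (𝓞 K))) vbar hvbar Φ.incl Φ.proj Φ.incl_smul Φ.proj_smul Φ.incl_injective
    Φ.proj_surjective (fun b hb ↦ Φ.mem_range_incl_of_proj_eq_zero b hb) Φ.proj_incl j₁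
    (AddSubgroup.inclusion (geomTorsion_le_geomPrimaryTorsion (W.baseChange K) p)) j₃ hj₁ (fun _ _ ↦ rfl) hj₃ hj₁inj
    (AddSubgroup.inclusion_injective _) hj₃inj hr₁ hr₂ hr₃ (CharResidualSelmerCount.charModule_divisible θsub) hd₂
    (CharResidualSelmerCount.charModule_divisible θquot) (fun a ↦ Φ.continuous_smul_sub hcN₂ a) hcN₂
    (fun a ↦ Φ.continuous_smul_quot hcN₂ a) (CharResidualSelmerCount.continuous_smul_charModule θsub)
    ((W.baseChange K).continuous_smul_geomPrimaryTorsion p) (CharResidualSelmerCount.continuous_smul_charModule θquot)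
    hUi hU₁ hU₂ hU₃ c τ hreps₁ hreps₂ hreps₃ hsur₁ hsur₂ hsur₃ hdiv₁ hdiv₂ hdiv₃ hlrs hprim₁ hprim₂ hprim₃ hinv₁ hinv₂ hinv₃
    hN₂ hε hN₁D htrivD hN₃ hinvD₁ hinvD₃ hH2
  exact IndexPlumbingNrVsStrict.stub_indexPlumbing h411 h422 h5A h41 h42 h32 h33 hT4 stub_publishedFactsMore.1 W p hp hgood hred hanom hlat K hK hH
    hHp htor ι v vbar hv hvbar hne κ hκ γ θsub θquot hpair Sf hSf DSsub DSquot c τ hτ hdist hreps₁ hreps₂ hreps₃ hsur₁ hsur₃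
    hmid hfgS htorS hμS hSsub hSquot

/-- **THE CRUX BY NAME — `Theses.EisensteinPrimes.GoodLatticeBDPValue` — from the FOUR v23 stub statements as hypotheses**
(v23's composition `GoodLatticeBDPValue_of` with the stubs by value): the landed terminal consumer
`GoodLatticeBDPValueStubOneOfPrint.goodLatticeBDPValue_of_print_of_leTD_of_le_of_anQ` (p662689: stub 1's five PUB inputs feed H1 /
L-div / L-val through the width seats' Carayol-free leaves and the CM road — no Castella–Hsieh, no Carayol, CGLS 5.1.3 (disc)) on
the eight Greenberg-type inputs `publishedFactsGreenberg_v22` (stub 4's two research + two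
textbook facts; BCGKPST §3.3 from stub 1's Thm. 3.3.1), [ALG-imp-λ] `imprimLambdaLE_of_index`,
[PWL-θ] (`≥`-half on stubs 4/4b.1, upgraded by the prop125 chain), the `f`-side `≤` (`FSideCorankLe.stub_fSideCorankLe`, p618030)
and [AN]-DS-Free in the ℚ-currency: w5 gen 2's `GoodLatticeBDPValueOfNamedFactsSix.anQ_of_thm222_OPEN` (p662183) at `thm222_anacong_goodLattice_OPEN`, itself from 3a-A at the datum of the closed stub 3a-B and the `5 ≤ p` slice by `GoodLatticeBDPValueAnThreeBookkeeping.thm222_OPEN_of_fullDescentDatum_of_five_le` (p660970). CONDITIONAL on exactly the four hypotheses (twelve published named facts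
∧ 3a-A); closes nothing by itself; BSD is proved for no curve. [claim: KellerYin2024, status: under-review]
[cite: KellerYin2024, Thm. 3.0.8 (IMC2) and proof (arXiv:2402.12781v2 TeX L1631–1640), Thm. 1.4.1, proof of Thm. 1.5.1, Thms. 2.2.1–2.2.3]
[cite: CastellaGrossiLeeSkinner2022, proof of Thm. 4.2.2, Thm. 5.1.3 with (disc), Thm. 2.1.2, Thms. 2.2.1/2.2.2 with (2.16), proof of Thm. 1.5.1, Prop. 1.2.5]
[cite: Kriz2016, Def. 31, Rem. 33, Thm. 34 (3), Thm. 35] [cite: BleherEtAl2020, §3.3 Thm. 3.3.1] [cite: deShalit1987, II.6.4 Theorem (i)]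
[cite: Hida2010MuInvariant, Thm. I] [cite: Greenberg2016Selmer, Prop. 4.1.1, Prop. 2.6.3] [cite: Greenberg2006, pp. 343–344] [cite: NguyenQuangDo1984, Thm. 2.2]
[cite: MilneADT2006, I Thm. 5.1] [cite: Harari2020, Thm. 17.13 (a)] [cite: PollackWeston2011, App. A Prop. A.2] -/
theorem goodLatticeBDPValue_of_namedFacts₂₃
    (stub_publishedFacts :
      proofThm422_exists_isBDPLFunction_isTorsion_charIdeal_dvd ∧
        thm513_exists_isBDPLFunction_valueAtOne_disc ∧
        thm331_rubin_exists_katzMeasure₂_pseudoIso_span_eq ∧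
        thmII64_katzMeasure₂_functionalEquation ∧
        thmI_mu_katzBranch_reflect_eq_zero)
    (stub_anacongOfFullDescentDatum :
    ∀ (W : WeierstrassCurve ℚ) [W.IsElliptic] [W.IsGloballyMinimal] (p : ℕ) [Fact p.Prime],
      2 < p → Good W p → Red W p → Anom W p →
      ((∃ (ℓ : ℕ) (hℓ : ℓ.Prime), haveI : Fact ℓ.Prime := ⟨hℓ⟩; Addv W ℓ) ∨
        (∃ (ℓ : ℕ) (hℓ : ℓ.Prime), haveI : Fact ℓ.Prime := ⟨hℓ⟩;
          W.HasMultiplicativeReductionAtPrime ℓ ∧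
            ((W.HasSplitMultiplicativeReductionAtPrime ℓ ∧ ℓ ≡ 1 [MOD p]) ∨
              (¬ W.HasSplitMultiplicativeReductionAtPrime ℓ ∧ ℓ + 1 ≡ 0 [MOD p])))) →
      (∀ Φ : AddSubgroup (geomTorsion W (p : ℤ)), IsRationalLine W p Φ → ¬ LineUnramifiedAt W p Φ) →
      ∀ (K : Type) [Field K] [NumberField K], IsImaginaryQuadratic K →
        SatisfiesHeegnerHypothesis (W.conductorNorm ℤ) K → SatisfiesHeegnerHypothesis p K →
        Odd (NumberField.discr K) → NumberField.discr K ≠ -3 →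
        (∀ Q : (W.baseChange K).toAffine.Point, p • Q = 0 → Q = 0) →
      ∀ (ι : K →+* ℚ_[p]) (v vbar : HeightOneSpectrum (𝓞 K)),
        (∀ x : 𝓞 K, x ∈ v.asIdeal ↔ ‖ι (x : K)‖ < 1) →
        ((p : ℕ) : 𝓞 K) ∈ vbar.asIdeal → vbar ≠ v →
      ∀ (κ : ZpExtension K p), κ.IsAnticyclotomic →
      ∀ (γ : absoluteGaloisGroup K) [Fact (κ.IsTopGenerator γ)],
      ∀ (N : ℕ) [NeZero N] (Dt : ModularParametrizationData W N),
      ∀ (ι' : PadicAlgCl p ≃+* ℂ),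
        (∀ (w : InfinitePlace K) (k : 𝓞 K), k ∈ v.asIdeal ↔ ‖ι'.symm (w.embedding (k : K))‖ < 1) →
      ∀ (ΩK : ℂ) (Ωp : (unrIntegers p)ˣ) (L : UnrSeries p), ΩK ≠ 0 →
        IsBDPLFunction ι' v κ γ Dt.f ΩK ((Ωp : unrIntegers p) : ℂ_[p]) L →
      ∀ (θsub θquot : FramedGaloisRep K (padicCoeffIntegers (∅ : Set (PadicAlgCl p))) 1),
        IsResidualPairOver (W.baseChange K) p θsub θquot →
      ∀ (Sf : Finset (HeightOneSpectrum (𝓞 K))),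
        (∀ w : HeightOneSpectrum (𝓞 K), w ∈ Sf ↔ ((W.conductorNorm ℤ : ℤ) : 𝓞 K) ∈ w.asIdeal) →
      ∀ (θK : HeckeCharacter K), IsHeckeCharOf ι' θquot θK →
      ∀ (Cbar : Finset (HeightOneSpectrum (𝓞 K))), (∀ u ∈ Cbar, ¬ θK.IsUnramifiedAt u) →
      ∀ (ΩK' : ℂ) (Ωp' : (unrIntegers p)ˣ) (Lφ : UnrSeries p), ΩK' ≠ 0 →
        IsKatzLFunction ι' v vbar Cbar κ γ θK ΩK' ((Ωp' : unrIntegers p) : ℂ_[p]) Lφ →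
      ∃ n nφ : ℕ, FirstUnitCoeffAt L n ∧ FirstUnitCoeffAt Lφ nφ ∧
        n + ∑ w ∈ Sf, curveLocalLambda κ (W.baseChange K) w =
          2 * nφ + ∑ w ∈ Sf, (charLocalLambda ∅ κ θsub w + charLocalLambda ∅ κ θquot w))
    (stub_publishedFactsGreenberg :
      prop411_selmer_isAlmostDivisible ∧ weakLeopoldt_H2_subsingleton_above_cyclotomic_of_isOpen ∧
        (∀ (L : Type) [Field L] [NumberField L], Literature.NumberTheory.GaloisCohomology.tateGlobalEulerPoincareCharacteristic L) ∧
        (∀ (L : Type) [Field L] [NumberField L], Literature.NumberTheory.GaloisCohomology.poitouTate_restricted_three_le L))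
    (stub_publishedFactsMore :
      prop263_sur_of_crk ∧ thm222_anacong_goodLattice_of_five_le ∧ thm212_exists_isKatzLFunction) :
    Summit.BirchSwinnertonDyer.BirchSwinnertonDyer.Theses.EisensteinPrimes.GoodLatticeBDPValue := by
  obtain ⟨h411, h422, h5A, h41, h42, h32, h33, hT4⟩ :=
    publishedFactsGreenberg_v22 stub_publishedFacts stub_publishedFactsGreenberg
  exact GoodLatticeBDPValueStubOneOfPrint.goodLatticeBDPValue_of_print_of_leTD_of_le_of_anQ
    stub_publishedFacts.1 stub_publishedFacts.2.1 stub_publishedFacts.2.2.1 stub_publishedFacts.2.2.2.1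
    stub_publishedFacts.2.2.2.2 h411 h422 h5A h41 h42 h32 h33 hT4
    (imprimLambdaLE_of_index stub_publishedFacts stub_publishedFactsGreenberg stub_publishedFactsMore)
    (prop125_imprimitive_of_quotient
      (prop125_quotient_of_corank (prop125_corank_of_ge
        (AcTwistDeformation.prop125_residualPair_unrSelmer_corank_ge_of_facts stub_publishedFactsMore.1 h41 h42 h5A h32))))
    FSideCorankLe.stub_fSideCorankLe
    (GoodLatticeBDPValueOfNamedFactsSix.anQ_of_thm222_OPEN stub_publishedFacts.2.2.2.1
      (GoodLatticeBDPValueAnThreeBookkeeping.thm222_OPEN_of_fullDescentDatum_of_five_le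
        stub_anacongOfFullDescentDatum stub_publishedFactsMore.2.1)
      stub_publishedFactsMore.2.2)

end Summit.BirchSwinnertonDyer.BirchSwinnertonDyer.Theorems.GoodLatticeBDPValueOfNamedFactsV23
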